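import Literature.MathematicalPhysics.QuantumFieldTheory.Balaban1983to89.B9Eq3153FrakGkBoundSlotDiagonal
import Literature.MathematicalPhysics.QuantumFieldTheory.Balaban1983to89.B9Eq3153FrakGLipschitzEnergy
import Literature.MathematicalPhysics.QuantumFieldTheory.Balaban1983to89.B9Eq384RemainderLetters
import Literature.MathematicalPhysics.QuantumFieldTheory.Balaban1983to89.B9Eq373DerivativeRemainderL2
import Literature.MathematicalPhysics.QuantumFieldTheory.Balaban1983to89.B5Eq172HodgePositivity

/-!
# `Balaban1983to89.B9Eq3153FrakGkLipschitzSlotDiagonal` — T. Bałaban, *Propagators for lattice gauge theories in a background field*, Commun. Math. Phys. **99**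
# (1985) 389–434 [Balaban1985BackgroundPropagators] (3.153) ∕ Thm 3.13 p. 426, (3.130) p. 421, (3.122) p. 420, Thm 3.11 p. 416, with [Balaban1985Variational]
# (110)–(111) p. 294, ON PRINT's DIAGONAL `ηL^{n+1} = 1`: **THE THIRD GREEN's LETTER `𝔊̃_k` OF A HESSIAN-SLOT PERTURBATION DIFFERS FROM THE CHAIN's `𝔊_k(U)` BY
# `O(θ)` IN THE FLAT ENERGY NORM** — `‖P(𝔊̃_kx − 𝔊_kx)‖ ≤ C·θ·‖x‖`, `P ∈ {1, curl₁, div₁}`, for ANY slot `Δ₁` with `N₁`-form defect `θ ≤ γ₁∕2` against `Δ^η(U)`,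
# both operators symmetric, the chain's `K⁻¹`-letter `C_K` and the averaging norm `M_Q` DISPLAYED (constant closed in them); for `Δ₁ := π_k†Δ^ηπ_k` this is
# print's `𝔊` of (3.153) against the chain's `G₀`-proxy — step (iv-𝔊, Lipschitz) of the row OWNER t4-ne9-p1's plan v7 «the Δ_π port» (O-3, GO to leaf-03)

statement-level skeleton of published theorems with citation tags; proofs where landed; nothing here is a claim about the Yang–Mills mass gap

CITATION HEADER (lean-in-tree rule).  Audit cell `pub-balaban`, sub-cell `t4`, BINDER row NE9; filed by NE9 crux-team (2) leaf prover 03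
(`b2b-balaban-t4-ne9-formalise-leaf-03`, gen 67), INTENT I-ne9leaf03-g67-F2 (the OWNER's W-8 (γ) O-3 GO + his located obstacle O-ne9p1-g87-2 with repair (r2), used
here).  Sources READ in the held text `paper:balaban1985-cmp99-background-propagators` (journal page = PDF page + 388) pp. 416, 420–421, 426; [Balaban1985Variational]
(110)–(111) through the tree's quotations.  Objects BY NAME: `laplaceAk`, `QkW`, `RofUk`, `hessOp`, `laplaceALatticeK`, `frakGLatticeK`, `KinvLatticeK`, `covCurlL2K`,
`covDivL2K`, `covDerivL2K`; nothing re-declared, 0 `def`.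

THE PRINT (verbatim).  p. 426: *«(3.147), (3.153) permit us to reduce properties of 𝔓, 𝔊 to the corresponding properties of G′, (Q′G′²Q′*)⁻¹, G₁, (QG₁Q*)⁻¹ …
Theorem 3.13»*; p. 420: *«we will prove that this term is a small perturbation of Δ_a»*; p. 421: *«G = G₀(I − Δ′_πG₀)⁻¹ (3.130)»*; [B11] p. 294: *«G₁𝔓* = 𝔊 …
Q𝔊 = 0, RD*𝔊 = 0»*.

WHY THIS FILE (cell context).  The `𝔊`-row of the port's step (iv): `B9Eq3153FrakGLipschitzEnergy.norm_apply_frakG_sub_le` at structure 0 = the chain `Δ_{a,k}(U)` and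
structure 1 = the slot operator `Δ₁ + D_UR_kD*_U + Q_k*aQ_k`, which SHARE `Q_k(U)`, `D_U`, `R_k(U)`, `D*_U`: `δ_Q = δ_P = δ_D = δ_R = 0`, so the `K̃⁻¹`-letter `C₁`
multiplies zero (inhabited by the finite-dimensional operator norm — L-ne9leaf03g67-1, ADOPTED W-8 (β)); the structure-1 letters are `γ = γ₁∕2` and `c_R¹ = 4`
(`B9Eq3153FrakGkBoundSlotDiagonal` §1), the structure-0 letters `γ₀`, `c_R⁰ = 2` (the bare `exists_energy_letters_diagonal_closed`), `C_K`, `M_Q` displayed.  The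
OWNER's located obstacle O-ne9p1-g87-2: the abstract theorem wants `‖D*_Uw‖ ≤ N(w)` for the SAME weight as the rows; with `N = N₁` this fails by the transport defect
— repair (r2): the weight `N′ = K′·N₁`, `K′ = 1 + 2M_φM_φ′√d` (`‖D*_Uw‖ ≤ ‖D*₁w‖ + 2M_φM_φ′√d·α‖w‖ ≤ K′N₁(w)` for `α ≤ 1`, `B9Eq373DerivativeRemainderL2.norm_covDivL2K_sub_le`
at the transporter window), coercivities divided by `K′²`, the form defect `θN₁N₁ ≤ θN′N′`.

WHAT IS PROVED (sorry-free; proof lane — 0 `def`; [folklore] composition BY NAME + arithmetic).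
* **`exists_norm_frakGk_slot_sub_le_diagonal`** — `∃ α₀ γ₁ C > 0` (closed in `(d, a, L, M_φ, M_φ′, r, C_τ, ρ_w, C_K, M_Q)`) BEFORE the OWNER's INTENT-5 binders
  VERBATIM, then `∀ Δ₁ {θ} (0 ≤ θ ≤ γ₁∕2) hθ (hsymm₁ : Δ̃ symmetric) (hsymmU : Δ_{a,k}(U) symmetric) hpos₁ hposU hQ (hK : ‖(Q_kG_kQ_k†)⁻¹c‖ ≤ C_K‖c‖)
  (hQb : ‖Q_kw‖ ≤ M_Q‖w‖) x`: `‖P(𝔊̃_kx − 𝔊_kx)‖ ≤ C·θ·‖x‖` for `P ∈ {1, curl₁, div₁}`, `𝔊̃_k = frakGLatticeK hpos₁ hQ`, `𝔊_k = frakGLatticeK hposU hQ`.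
HONEST SCOPE.  [folklore]; θ, `C_K`, `M_Q`, both symmetries DISPLAYED; windows, E162's data, `hRS`, `ρ_w`, the profile, witnesses HYPOTHESES; FIRST order, energy currency
on the diagonal — no kernel bound, no decay, NOT the (N)-reading; crude constants.  «NE9 ⇐ the named binders»; NE9 NOT PRINTED ∕ NOT PROVED; NOT summit progress (cell
pub-balaban: row NE9 WALLED ON A MODEL (O-NE9-1; #5 UNRULED); spine PROVED 0/9; rung (B)+1 finite T⁴ — NOT infinite volume, NOT mass gap, NOT BetaPertH, NOT Clay;
HONEST DEPENDENCY: continuum YM on T⁴ ⇐ BetaPertH ∧ nine spine estimates (0/9 proved); BetaPertH ⇐ (D1) ∧ (D4) ∧ CAP+tail; G-an2-4 gates asym, D1 and NE2/3/4).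
NEW file; nothing modified.  Net new unproved facts: 0.
-/

noncomputable section

open scoped InnerProductSpace ComplexConjugate BigOperators

namespace Literature.MathematicalPhysics.QuantumFieldTheory.Balaban1983to89.B9Eq3153FrakGkLipschitzSlotDiagonal

open B4Sect5Torus (TSite)
open B9SectCLatticeCarrier (Bond)
open B11Eq103H1Complex (SiteL2K BondL2K covDerivL2K covDivL2K laplaceALatticeK laplaceAK laplaceAK_apply frakGLatticeK KinvLatticeK KinvK
  adjoint_injective_of_surjective adjoint_covDerivL2K projR_projR)
open B9Eq310HessianOperator (adTransportW hessOp covCurlL2K)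
open B9Eq310DeltaPrime (plaqHolU)
open B9Eq315QTorus (perCfg cornerSite)
open B9Eq315QTower (towerP UlevOf)
open B9Eq326OperatorTower (laplaceAk QkW RofUk RofUk_isSymmetric)
open B7Prop1Explicit (U1 Wcx boxVec)
open B9Eq373DerivativeRemainderL2 (norm_covDivL2K_sub_le)
open B9Eq368ProjectionRemainder (norm_projR_le)
open B9Eq384RemainderLetters (norm_adTransportW_sub_le)
open B5Eq172HodgePositivity (adTransportW_one adTransportW_inv_one)
open B9Eq3153FrakGkBoundDiagonal (exists_energy_letters_diagonal_closed)
open B9Eq3153FrakGkBoundSlotDiagonal (exists_energy_letters_slot_diagonal_closed)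
open B9Eq3153FrakGLipschitzEnergy (norm_apply_frakG_sub_le)

/-- `x ≤ √S` from `0 ≤ x` and `x² ≤ S`. [folklore] -/
private theorem le_sqrt_of_sq_le {x S : ℝ} (hx : 0 ≤ x) (h : x ^ 2 ≤ S) : x ≤ Real.sqrt S := by
  calc x = Real.sqrt (x ^ 2) := (Real.sqrt_sq hx).symm
    _ ≤ Real.sqrt S := Real.sqrt_le_sqrt h

variable {d : ℕ} (L : ℕ) [NeZero L] (hL : 1 ≤ L)
  {𝔸 : Type*} [NormedRing 𝔸] [NormedAlgebra ℂ 𝔸] [CompleteSpace 𝔸] [NormOneClass 𝔸] [StarRing 𝔸] [NormedStarGroup 𝔸] [StarModule ℂ 𝔸]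
  {W : Type*} [NormedAddCommGroup W] [InnerProductSpace ℂ W] [FiniteDimensional ℂ W] (φ : W ≃ₗ[ℂ] 𝔸)
  {Mφ Mφ' : ℝ} (hMφ : 0 ≤ Mφ) (hMφ' : 0 ≤ Mφ') (hφ : ∀ w, ‖φ w‖ ≤ Mφ * ‖w‖) (hφ' : ∀ X, ‖φ.symm X‖ ≤ Mφ' * ‖X‖)
  {a : ℝ} (ha : 0 < a) {r : ℝ} (hr0 : 0 ≤ r) (hr1 : r < 1)
  (τ : 𝔸 →ₗ[ℂ] ℂ) {Cτ : ℝ} (hτ : ∀ X, ‖τ X‖ ≤ Cτ * ‖X‖) (hCτ : 0 ≤ Cτ) {ρw : ℝ} (hρw : 0 ≤ ρw) {CK MQ : ℝ} (hCK : 0 ≤ CK) (hMQ : 0 ≤ MQ)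

include hMφ hMφ' hφ hφ' ha hr0 hr1 hτ hCτ hρw hCK hMQ

-- deep definitional unfolding `frakGLatticeK`∕`KinvLatticeK` ↦ `frakGLin (G1K …)`∕`KinvK` (as in `B9Eq3153FrakGkLipschitzEnergyDiagonal`)
set_option maxHeartbeats 800000 in
set_option maxRecDepth 8192 in
/-- **THE THIRD GREEN's LETTER OF A HESSIAN-SLOT PERTURBATION AGAINST THE CHAIN's `𝔊_k(U)`, IN THE FLAT ENERGY NORM, ON THE DIAGONAL** — see the module header:
`‖P(𝔊̃_kx − 𝔊_kx)‖ ≤ C·θ·‖x‖`, `P ∈ {1, curl₁, div₁}`, by `B9Eq3153FrakGLipschitzEnergy.norm_apply_frakG_sub_le` with `δ_Q = δ_P = δ_D = δ_R = 0`, `γ = (γ₁∕2)∕K′²`,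
`γ₀ = γ₀′∕K′²`, `Θ = θ`, `c_R⁰ = 2`, `c_R¹ = 4`, `M_P = M_R = 1`, `C₀ = C_K`, `C₁ =` the operator norm of `K̃⁻¹` (×0), weight `N′ = K′N₁` (repair (r2)). [folklore]
[cite: Balaban1985BackgroundPropagators, (3.153) p.426, Thm 3.13 p.426, (3.130) p.421, (3.122) p.420, Thm 3.11 p.416; Balaban1985Variational, (110)–(111) p.294] -/
theorem exists_norm_frakGk_slot_sub_le_diagonal :
    ∃ α₀ γ₁ C : ℝ, 0 < α₀ ∧ 0 < γ₁ ∧ 0 < C ∧ ∀ (n : ℕ) (η : ℝ), η * (L : ℝ) ^ (n + 1) = 1 →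
      ∀ (c₀ c₁ : ℝ) [Fact (0 < c₀)] [Fact (0 < c₁)], c₀ * ((L : ℝ) ^ (n + 1)) ^ d = c₁ → |η| ^ d / c₀ ≤ ρw →
      ∀ (m : Fin d → ℕ) [∀ i, NeZero (m i)] (U : Bond d (towerP L m (n + 1)) → 𝔸ˣ) (αU : ℕ → ℝ) (hα1 : ∀ j, αU j ≤ 1 / 64)
        (hU1 : ∀ (j : ℕ) (x : B7Prop1Explicit.Site d) (κ : Fin d), perCfg (towerP L m (j + 1)) (UlevOf L m (n + 1) U j) x κ ∈ U1 𝔸)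
        (hreg : ∀ (j : ℕ) (y : TSite d (towerP L m j)) (κ : Fin d) (r : Fin d → Fin L),
          ‖((Wcx L (perCfg (towerP L m (j + 1)) (UlevOf L m (n + 1) U j)) (cornerSite L y) κ (boxVec L r) : 𝔸ˣ) : 𝔸) - 1‖ ≤ αU j)
        (εU : ℕ → ℝ), (∀ j, 0 ≤ εU j) → (∀ (j : ℕ) (b : Bond d (towerP L m (j + 1))), ‖(UlevOf L m (n + 1) U j b : 𝔸) - 1‖ ≤ εU j) →
      ∀ {α : ℝ}, 0 ≤ α → α ≤ α₀ →
        (∀ (b : Bond d (towerP L m (n + 1))) (v u : W), ⟪adTransportW φ U b v, u⟫_ℂ = ⟪v, adTransportW φ (fun b => (U b)⁻¹) b u⟫_ℂ) →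
        (∀ b, U b ∈ U1 𝔸) → (∀ b, ‖(U b : 𝔸) - 1‖ ≤ α * η) →
        (∀ p : B9SectCLatticeCarrier.Plaq d (towerP L m (n + 1)), ‖(plaqHolU U p : 𝔸) - 1‖ ≤ α * η ^ 2) →
        (∀ j < n + 1, εU j ≤ α * r ^ j) →
        ∀ (Δ₁ : BondL2K ℂ d (towerP L m (n + 1)) c₀ W →ₗ[ℂ] BondL2K ℂ d (towerP L m (n + 1)) c₀ W) {θ : ℝ}, 0 ≤ θ → θ ≤ γ₁ / 2 →
        (∀ u v : BondL2K ℂ d (towerP L m (n + 1)) c₀ W, ‖⟪u, Δ₁ v⟫_ℂ - ⟪u, hessOp φ η U τ v⟫_ℂ‖ ≤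
            θ * Real.sqrt (‖covCurlL2K ℂ c₀ ((η : ℂ))⁻¹ (adTransportW φ (fun _ : Bond d (towerP L m (n + 1)) => (1 : 𝔸ˣ))) u‖ ^ 2 +
                  ‖covDivL2K ℂ c₀ ((η : ℂ))⁻¹ (adTransportW φ fun _ : Bond d (towerP L m (n + 1)) => (1 : 𝔸ˣ)⁻¹) u‖ ^ 2 + ‖u‖ ^ 2) *
                Real.sqrt (‖covCurlL2K ℂ c₀ ((η : ℂ))⁻¹ (adTransportW φ (fun _ : Bond d (towerP L m (n + 1)) => (1 : 𝔸ˣ))) v‖ ^ 2 +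
                  ‖covDivL2K ℂ c₀ ((η : ℂ))⁻¹ (adTransportW φ fun _ : Bond d (towerP L m (n + 1)) => (1 : 𝔸ˣ)⁻¹) v‖ ^ 2 + ‖v‖ ^ 2)) →
        (laplaceALatticeK ((η : ℂ))⁻¹ (adTransportW φ U) (adTransportW φ fun b => (U b)⁻¹) Δ₁ (RofUk L m n φ η U)
              (QkW L m n φ U hL αU hα1 hU1 hreg (c₁ := c₁)) a).IsSymmetric →
        (laplaceAk L m n φ η U hL αU hα1 hU1 hreg τ (c₀ := c₀) (c₁ := c₁) a).IsSymmetric →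
        ∀ (hpos₁ : ∀ x : BondL2K ℂ d (towerP L m (n + 1)) c₀ W, x ≠ 0 →
            0 < RCLike.re ⟪x, laplaceALatticeK ((η : ℂ))⁻¹ (adTransportW φ U) (adTransportW φ fun b => (U b)⁻¹) Δ₁ (RofUk L m n φ η U)
              (QkW L m n φ U hL αU hα1 hU1 hreg (c₁ := c₁)) a x⟫_ℂ)
          (hposU : ∀ x : BondL2K ℂ d (towerP L m (n + 1)) c₀ W, x ≠ 0 →
            0 < RCLike.re ⟪x, laplaceAk L m n φ η U hL αU hα1 hU1 hreg τ (c₀ := c₀) (c₁ := c₁) a x⟫_ℂ)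
          (hQ : Function.Surjective (QkW L m n φ U hL αU hα1 hU1 hreg (c₀ := c₀) (c₁ := c₁))),
        (∀ c : BondL2K ℂ d m c₁ W, ‖KinvLatticeK hposU hQ c‖ ≤ CK * ‖c‖) →
        (∀ w : BondL2K ℂ d (towerP L m (n + 1)) c₀ W, ‖QkW L m n φ U hL αU hα1 hU1 hreg (c₀ := c₀) (c₁ := c₁) w‖ ≤ MQ * ‖w‖) →
        ∀ x : BondL2K ℂ d (towerP L m (n + 1)) c₀ W,
          ‖frakGLatticeK hpos₁ hQ x - frakGLatticeK hposU hQ x‖ ≤ C * θ * ‖x‖ ∧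
          ‖covCurlL2K ℂ c₀ ((η : ℂ))⁻¹ (adTransportW φ (fun _ : Bond d (towerP L m (n + 1)) => (1 : 𝔸ˣ)))
            (frakGLatticeK hpos₁ hQ x - frakGLatticeK hposU hQ x)‖ ≤ C * θ * ‖x‖ ∧
          ‖covDivL2K ℂ c₀ ((η : ℂ))⁻¹ (adTransportW φ fun _ : Bond d (towerP L m (n + 1)) => (1 : 𝔸ˣ)⁻¹)
            (frakGLatticeK hpos₁ hQ x - frakGLatticeK hposU hQ x)‖ ≤ C * θ * ‖x‖ := by
  have hL0 : (0 : ℝ) < (L : ℝ) := by exact_mod_cast Nat.pos_of_ne_zero (NeZero.ne L)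
  -- the slot letters and the bare letters
  obtain ⟨α₁, γ₁, hα₁, hγ₁, HS⟩ := exists_energy_letters_slot_diagonal_closed (d := d) L hL φ hMφ hMφ' hφ hφ' ha hr0 hr1 τ hτ hCτ hρw
  obtain ⟨α₂, γ₀, hα₂, hγ₀, HB⟩ := exists_energy_letters_diagonal_closed (d := d) L hL φ hMφ hMφ' hφ hφ' ha hr0 hr1 τ hτ hCτ hρw
  -- the weight factor `K′ = 1 + 2M_φM_φ′√d` (repair (r2))
  obtain ⟨K', hK'def⟩ : ∃ K' : ℝ, K' = 1 + 2 * Mφ * Mφ' * Real.sqrt d := ⟨_, rfl⟩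
  have hK'1 : 1 ≤ K' := by
    have h0 : 0 ≤ 2 * Mφ * Mφ' * Real.sqrt d := by positivity
    rw [hK'def]; linarith
  have hK'0 : 0 < K' := lt_of_lt_of_le one_pos hK'1
  obtain ⟨g, hgdef⟩ : ∃ g : ℝ, g = γ₁ / 2 / K' ^ 2 := ⟨_, rfl⟩
  obtain ⟨g0, hg0def⟩ : ∃ g0 : ℝ, g0 = γ₀ / K' ^ 2 := ⟨_, rfl⟩
  have hg : 0 < g := by rw [hgdef]; positivity
  have hg0 : 0 < g0 := by rw [hg0def]; positivity
  -- the constant: the abstract expression at `Θ := 1`, all `δ := 0`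
  obtain ⟨Cb, hCbdef⟩ : ∃ Cb : ℝ, Cb = 1 / g * g0⁻¹ + (((1 * Real.sqrt (CK / g0)) / g) * MQ * g⁻¹ + Real.sqrt (CK / g0) * (MQ * (1 / g) * g0⁻¹)) +
      (Real.sqrt (g⁻¹ * 4) * (1 * (1 / g) * g0⁻¹) + (1 / g * Real.sqrt (2 / g0)) * 1 * g0⁻¹) := ⟨_, rfl⟩
  have hCb : 0 < Cb := by rw [hCbdef]; positivity
  refine ⟨min α₁ (min α₂ 1), γ₁, Cb, lt_min hα₁ (lt_min hα₂ one_pos), hγ₁, hCb, ?_⟩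
  intro n η hηL c₀ c₁ _ _ hw hρ m _ U αU hα1 hU1 hreg εU hεU hUε α hα0 hαle hRS hUb hUη hpl hεg Δ₁ θ hθ0 hθle hθ hsymm1 hsymmU hpos₁ hposU hQ hK hQb x
  have hαα₁ : α ≤ α₁ := hαle.trans (min_le_left _ _)
  have hαα₂ : α ≤ α₂ := hαle.trans ((min_le_right _ _).trans (min_le_left _ _))
  have hαone : α ≤ 1 := hαle.trans ((min_le_right _ _).trans (min_le_right _ _))
  have hLr : (0 : ℝ) < (L : ℝ) ^ (n + 1) := pow_pos hL0 _
  have hηL0 : 0 < η * (L : ℝ) ^ (n + 1) := by rw [hηL]; exact one_pos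
  have hη0 : 0 < η := pos_of_mul_pos_left hηL0 hLr.le
  have hc : conj ((η : ℂ))⁻¹ = ((η : ℂ))⁻¹ := by rw [map_inv₀, Complex.conj_ofReal]
  have HSx := HS n η hηL c₀ c₁ hw hρ m U αU hα1 hU1 hreg εU hεU hUε hα0 hαα₁ hRS hUb hUη hpl hεg Δ₁ hθ0 hθle hθ
  have HBx := HB n η hηL c₀ c₁ hw hρ m U αU hα1 hU1 hreg εU hεU hUε hα0 hαα₂ hRS hUb hUη hpl hεg
  -- the flat energy weight `N₁` and the scaled weight `N′ = K′N₁`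
  obtain ⟨N1, hN1def⟩ : ∃ N1 : BondL2K ℂ d (towerP L m (n + 1)) c₀ W → ℝ, N1 = fun z =>
      Real.sqrt (‖covCurlL2K ℂ c₀ ((η : ℂ))⁻¹ (adTransportW φ (fun _ : Bond d (towerP L m (n + 1)) => (1 : 𝔸ˣ))) z‖ ^ 2 +
        ‖covDivL2K ℂ c₀ ((η : ℂ))⁻¹ (adTransportW φ fun _ : Bond d (towerP L m (n + 1)) => (1 : 𝔸ˣ)⁻¹) z‖ ^ 2 + ‖z‖ ^ 2) := ⟨_, rfl⟩
  have hN1z : ∀ z, N1 z = Real.sqrt (‖covCurlL2K ℂ c₀ ((η : ℂ))⁻¹ (adTransportW φ (fun _ : Bond d (towerP L m (n + 1)) => (1 : 𝔸ˣ))) z‖ ^ 2 +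
        ‖covDivL2K ℂ c₀ ((η : ℂ))⁻¹ (adTransportW φ fun _ : Bond d (towerP L m (n + 1)) => (1 : 𝔸ˣ)⁻¹) z‖ ^ 2 + ‖z‖ ^ 2) := fun z => by rw [hN1def]
  have hN10 : ∀ z, 0 ≤ N1 z := fun z => by rw [hN1z]; exact Real.sqrt_nonneg _
  have hN1sq : ∀ z, N1 z ^ 2 = ‖covCurlL2K ℂ c₀ ((η : ℂ))⁻¹ (adTransportW φ (fun _ : Bond d (towerP L m (n + 1)) => (1 : 𝔸ˣ))) z‖ ^ 2 +
        ‖covDivL2K ℂ c₀ ((η : ℂ))⁻¹ (adTransportW φ fun _ : Bond d (towerP L m (n + 1)) => (1 : 𝔸ˣ)⁻¹) z‖ ^ 2 + ‖z‖ ^ 2 := fun z => by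
    rw [hN1z]; exact Real.sq_sqrt (add_nonneg (add_nonneg (sq_nonneg _) (sq_nonneg _)) (sq_nonneg _))
  have hN1n : ∀ z, ‖z‖ ≤ N1 z := fun z => by
    rw [hN1z]; exact le_sqrt_of_sq_le (norm_nonneg _) (le_add_of_nonneg_left (add_nonneg (sq_nonneg _) (sq_nonneg _)))
  have hN1c : ∀ z, ‖covCurlL2K ℂ c₀ ((η : ℂ))⁻¹ (adTransportW φ (fun _ : Bond d (towerP L m (n + 1)) => (1 : 𝔸ˣ))) z‖ ≤ N1 z := fun z => by
    rw [hN1z]; exact le_sqrt_of_sq_le (norm_nonneg _) ((le_add_of_nonneg_right (sq_nonneg _)).trans (le_add_of_nonneg_right (sq_nonneg _)))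
  have hN1d : ∀ z, ‖covDivL2K ℂ c₀ ((η : ℂ))⁻¹ (adTransportW φ fun _ : Bond d (towerP L m (n + 1)) => (1 : 𝔸ˣ)⁻¹) z‖ ≤ N1 z := fun z => by
    rw [hN1z]; exact le_sqrt_of_sq_le (norm_nonneg _) ((le_add_of_nonneg_left (sq_nonneg _)).trans (le_add_of_nonneg_right (sq_nonneg _)))
  obtain ⟨N, hNdef⟩ : ∃ N : BondL2K ℂ d (towerP L m (n + 1)) c₀ W → ℝ, N = fun z => K' * N1 z := ⟨_, rfl⟩
  have hNz : ∀ z, N z = K' * N1 z := fun z => by rw [hNdef]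
  have hN1N : ∀ z, N1 z ≤ N z := fun z => by rw [hNz]; exact le_mul_of_one_le_left (hN10 z) hK'1
  have hN0 : ∀ z, 0 ≤ N z := fun z => (hN10 z).trans (hN1N z)
  have hNn : ∀ z, ‖z‖ ≤ N z := fun z => (hN1n z).trans (hN1N z)
  have hNc : ∀ z, ‖covCurlL2K ℂ c₀ ((η : ℂ))⁻¹ (adTransportW φ (fun _ : Bond d (towerP L m (n + 1)) => (1 : 𝔸ˣ))) z‖ ≤ N z := fun z => (hN1c z).trans (hN1N z)
  have hNd : ∀ z, ‖covDivL2K ℂ c₀ ((η : ℂ))⁻¹ (adTransportW φ fun _ : Bond d (towerP L m (n + 1)) => (1 : 𝔸ˣ)⁻¹) z‖ ≤ N z := fun z => (hN1d z).trans (hN1N z)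
  have hNid : ∀ z : BondL2K ℂ d (towerP L m (n + 1)) c₀ W,
      ‖(LinearMap.id : BondL2K ℂ d (towerP L m (n + 1)) c₀ W →ₗ[ℂ] BondL2K ℂ d (towerP L m (n + 1)) c₀ W) z‖ ≤ N z := fun z => by
    rw [LinearMap.id_apply]; exact hNn z
  have hNsq : ∀ z, N z ^ 2 = K' ^ 2 * N1 z ^ 2 := fun z => by rw [hNz]; ring
  -- coercivities in the scaled weight
  have hcoer1 : ∀ z, g * N z ^ 2 ≤ RCLike.re ⟪z, laplaceALatticeK ((η : ℂ))⁻¹ (adTransportW φ U) (adTransportW φ fun b => (U b)⁻¹) Δ₁ (RofUk L m n φ η U)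
      (QkW L m n φ U hL αU hα1 hU1 hreg (c₁ := c₁)) a z⟫_ℂ := fun z => by
    have h := (HSx z).1
    rw [← hN1sq] at h
    rw [hgdef, hNsq, show γ₁ / 2 / K' ^ 2 * (K' ^ 2 * N1 z ^ 2) = γ₁ / 2 * N1 z ^ 2 by field_simp]
    exact h
  have hcoer0 : ∀ z, g0 * N z ^ 2 ≤ RCLike.re ⟪z, laplaceAk L m n φ η U hL αU hα1 hU1 hreg τ (c₀ := c₀) (c₁ := c₁) a z⟫_ℂ := fun z => by
    have h := (HBx z).1
    rw [← hN1sq] at h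
    rw [hg0def, hNsq, show γ₀ / K' ^ 2 * (K' ^ 2 * N1 z ^ 2) = γ₀ * N1 z ^ 2 by field_simp]
    exact h
  -- the form defect in the scaled weight
  have key : ∀ u v : BondL2K ℂ d (towerP L m (n + 1)) c₀ W,
      ⟪u, laplaceALatticeK ((η : ℂ))⁻¹ (adTransportW φ U) (adTransportW φ fun b => (U b)⁻¹) Δ₁ (RofUk L m n φ η U)
          (QkW L m n φ U hL αU hα1 hU1 hreg (c₁ := c₁)) a v⟫_ℂ -
        ⟪u, laplaceAk L m n φ η U hL αU hα1 hU1 hreg τ (c₀ := c₀) (c₁ := c₁) a v⟫_ℂ = ⟪u, Δ₁ v⟫_ℂ - ⟪u, hessOp φ η U τ v⟫_ℂ := by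
    intro u v
    simp only [laplaceAk, laplaceALatticeK, laplaceAK_apply, inner_add_right]
    ring
  have hT : ∀ u v : BondL2K ℂ d (towerP L m (n + 1)) c₀ W,
      ‖⟪u, laplaceALatticeK ((η : ℂ))⁻¹ (adTransportW φ U) (adTransportW φ fun b => (U b)⁻¹) Δ₁ (RofUk L m n φ η U)
          (QkW L m n φ U hL αU hα1 hU1 hreg (c₁ := c₁)) a v⟫_ℂ -
        ⟪u, laplaceAk L m n φ η U hL αU hα1 hU1 hreg τ (c₀ := c₀) (c₁ := c₁) a v⟫_ℂ‖ ≤ θ * N u * N v := fun u v => by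
    rw [key]
    have h1 : ‖⟪u, Δ₁ v⟫_ℂ - ⟪u, hessOp φ η U τ v⟫_ℂ‖ ≤ θ * N1 u * N1 v := by
      rw [hN1z u, hN1z v, mul_assoc]; exact (hθ u v).trans_eq (by ring)
    have h2 : θ * N1 u * N1 v ≤ θ * N u * N v := by
      have := mul_le_mul (hN1N u) (hN1N v) (hN10 v) (hN0 u)
      calc θ * N1 u * N1 v = θ * (N1 u * N1 v) := by ring
        _ ≤ θ * (N u * N v) := mul_le_mul_of_nonneg_left this hθ0
        _ = θ * N u * N v := by ring
    exact h1.trans h2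
  -- zero defects: the two structures share `Q_k`, `D_U`, `R_k`, `D*_U`
  have hQd : ∀ w : BondL2K ℂ d (towerP L m (n + 1)) c₀ W,
      ‖QkW L m n φ U hL αU hα1 hU1 hreg (c₀ := c₀) (c₁ := c₁) w - QkW L m n φ U hL αU hα1 hU1 hreg (c₀ := c₀) (c₁ := c₁) w‖ ≤ 0 * ‖w‖ := fun w => by
    rw [sub_self, norm_zero, zero_mul]
  have hPd : ∀ w : BondL2K ℂ d (towerP L m (n + 1)) c₀ W,
      ‖RofUk L m n φ η U (covDivL2K ℂ c₀ ((η : ℂ))⁻¹ (adTransportW φ fun b => (U b)⁻¹) w) -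
        RofUk L m n φ η U (covDivL2K ℂ c₀ ((η : ℂ))⁻¹ (adTransportW φ fun b => (U b)⁻¹) w)‖ ≤ 0 * N w := fun w => by
    rw [sub_self, norm_zero, zero_mul]
  have hDd : ∀ s : SiteL2K ℂ d (towerP L m (n + 1)) c₀ W,
      ‖covDerivL2K ℂ c₀ ((η : ℂ))⁻¹ (adTransportW φ U) s - covDerivL2K ℂ c₀ ((η : ℂ))⁻¹ (adTransportW φ U) s‖ ≤ 0 * ‖s‖ := fun s => by
    rw [sub_self, norm_zero, zero_mul]
  have hRd : ∀ t : SiteL2K ℂ d (towerP L m (n + 1)) c₀ W, ‖RofUk L m n φ η U t - RofUk L m n φ η U t‖ ≤ 0 * ‖t‖ := fun t => by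
    rw [sub_self, norm_zero, zero_mul]
  -- the projection letters
  have hRle : ∀ v : SiteL2K ℂ d (towerP L m (n + 1)) c₀ W, ‖RofUk L m n φ η U v‖ ≤ ‖v‖ := fun v => by
    unfold RofUk B11Eq103H1Complex.RLatticeK; exact norm_projR_le _ _ v
  have hR1 : ∀ t : SiteL2K ℂ d (towerP L m (n + 1)) c₀ W, ‖RofUk L m n φ η U t‖ ≤ 1 * ‖t‖ := fun t => by rw [one_mul]; exact hRle t
  -- `‖D*_Uw‖ ≤ K′N₁(w) = N(w)` (the transporter window, `α ≤ 1`)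
  have hεR : 0 ≤ 2 * Mφ * Mφ' * (α * η) := by positivity
  have hRw : ∀ (b : Bond d (towerP L m (n + 1))) (v : W), ‖adTransportW φ U b v - v‖ ≤ 2 * Mφ * Mφ' * (α * η) * ‖v‖ :=
    fun b v => norm_adTransportW_sub_le φ hφ hφ' hMφ' U b (hUb b) (hUη b) v
  have hR₁ : ∀ (b : Bond d (towerP L m (n + 1))) (v : W), adTransportW φ (fun _ : Bond d (towerP L m (n + 1)) => (1 : 𝔸ˣ)) b v = v :=
    fun b v => by rw [adTransportW_one]; rfl
  have hS₁ : ∀ (b : Bond d (towerP L m (n + 1))) (v : W), adTransportW φ (fun _ : Bond d (towerP L m (n + 1)) => (1 : 𝔸ˣ)⁻¹) b v = v :=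
    fun b v => by rw [adTransportW_inv_one]; rfl
  have hηn : ‖((η : ℂ))⁻¹‖ * (2 * Mφ * Mφ' * (α * η)) * Real.sqrt d = 2 * Mφ * Mφ' * Real.sqrt d * α := by
    rw [norm_inv, Complex.norm_real, Real.norm_eq_abs, abs_of_pos hη0]; field_simp
  have hDs0 : ∀ w : BondL2K ℂ d (towerP L m (n + 1)) c₀ W, ‖covDivL2K ℂ c₀ ((η : ℂ))⁻¹ (adTransportW φ fun b => (U b)⁻¹) w‖ ≤ N w := by
    intro w
    have hdiff := norm_covDivL2K_sub_le (𝕜 := ℂ) (c₀ := c₀) ((η : ℂ))⁻¹ hc hεR hRw hR₁ hRS hS₁ w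
    rw [hηn] at hdiff
    have h1 : ‖covDivL2K ℂ c₀ ((η : ℂ))⁻¹ (adTransportW φ fun b => (U b)⁻¹) w‖ ≤
        ‖covDivL2K ℂ c₀ ((η : ℂ))⁻¹ (adTransportW φ fun _ : Bond d (towerP L m (n + 1)) => (1 : 𝔸ˣ)⁻¹) w‖ + 2 * Mφ * Mφ' * Real.sqrt d * α * ‖w‖ :=
      (norm_le_insert' _ _).trans (add_le_add le_rfl hdiff)
    have h2 : 2 * Mφ * Mφ' * Real.sqrt d * α * ‖w‖ ≤ 2 * Mφ * Mφ' * Real.sqrt d * N1 w := by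
      have h3 : α * ‖w‖ ≤ 1 * N1 w := mul_le_mul hαone (hN1n w) (norm_nonneg _) zero_le_one
      have h4 : 0 ≤ 2 * Mφ * Mφ' * Real.sqrt d := by positivity
      nlinarith
    calc _ ≤ N1 w + 2 * Mφ * Mφ' * Real.sqrt d * N1 w := h1.trans (add_le_add (hN1d w) h2)
      _ = N w := by rw [hNz, hK'def]; ring
  have hP0 : ∀ w : BondL2K ℂ d (towerP L m (n + 1)) c₀ W,
      ‖RofUk L m n φ η U (covDivL2K ℂ c₀ ((η : ℂ))⁻¹ (adTransportW φ fun b => (U b)⁻¹) w)‖ ≤ 1 * N w := fun w => by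
    rw [one_mul]; exact (hRle _).trans (hDs0 w)
  -- the `RD*` letters `c_R⁰ = 2`, `c_R¹ = 4`
  have hRD1 : ∀ y : BondL2K ℂ d (towerP L m (n + 1)) c₀ W, ‖RofUk L m n φ η U (covDivL2K ℂ c₀ ((η : ℂ))⁻¹ (adTransportW φ fun b => (U b)⁻¹) y)‖ ^ 2 ≤
      4 * RCLike.re ⟪y, laplaceALatticeK ((η : ℂ))⁻¹ (adTransportW φ U) (adTransportW φ fun b => (U b)⁻¹) Δ₁ (RofUk L m n φ η U)
        (QkW L m n φ U hL αU hα1 hU1 hreg (c₁ := c₁)) a y⟫_ℂ := fun y => (HSx y).2.1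
  have hRD0 : ∀ y : BondL2K ℂ d (towerP L m (n + 1)) c₀ W, ‖RofUk L m n φ η U (covDivL2K ℂ c₀ ((η : ℂ))⁻¹ (adTransportW φ fun b => (U b)⁻¹) y)‖ ^ 2 ≤
      2 * RCLike.re ⟪y, laplaceAk L m n φ η U hL αU hα1 hU1 hreg τ (c₀ := c₀) (c₁ := c₁) a y⟫_ℂ := fun y => (HBx y).2.1
  -- the `K̃⁻¹`-letter of the slot: operator norm (×0)
  obtain ⟨C₁, hC₁, hK₁⟩ : ∃ C₁ : ℝ, 0 ≤ C₁ ∧ ∀ c : BondL2K ℂ d m c₁ W, ‖KinvLatticeK hpos₁ hQ c‖ ≤ C₁ * ‖c‖ := by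
    refine ⟨‖LinearMap.toContinuousLinearMap (KinvLatticeK hpos₁ hQ)‖, norm_nonneg _, fun c => ?_⟩
    exact (LinearMap.toContinuousLinearMap (KinvLatticeK hpos₁ hQ)).le_opNorm c
  -- structure letters
  have hadj : ∀ (y : BondL2K ℂ d (towerP L m (n + 1)) c₀ W) (z : BondL2K ℂ d m c₁ W),
      ⟪QkW L m n φ U hL αU hα1 hU1 hreg (c₀ := c₀) (c₁ := c₁) y, z⟫_ℂ = ⟪y, LinearMap.adjoint (QkW L m n φ U hL αU hα1 hU1 hreg (c₀ := c₀) (c₁ := c₁)) z⟫_ℂ :=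
    fun y z => (LinearMap.adjoint_inner_right _ y z).symm
  have hinj := adjoint_injective_of_surjective _ hQ
  have hDDU : ∀ (s : SiteL2K ℂ d (towerP L m (n + 1)) c₀ W) (y : BondL2K ℂ d (towerP L m (n + 1)) c₀ W),
      ⟪covDerivL2K ℂ c₀ ((η : ℂ))⁻¹ (adTransportW φ U) s, y⟫_ℂ = ⟪s, covDivL2K ℂ c₀ ((η : ℂ))⁻¹ (adTransportW φ fun b => (U b)⁻¹) y⟫_ℂ := by
    intro s y; rw [← adjoint_covDerivL2K ((η : ℂ))⁻¹ hc _ _ hRS, LinearMap.adjoint_inner_right]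
  have hRsymU : ∀ s t : SiteL2K ℂ d (towerP L m (n + 1)) c₀ W, ⟪RofUk L m n φ η U s, t⟫_ℂ = ⟪s, RofUk L m n φ η U t⟫_ℂ :=
    fun s t => RofUk_isSymmetric L m n φ η U s t
  have hRRU : ∀ s : SiteL2K ℂ d (towerP L m (n + 1)) c₀ W, RofUk L m n φ η U (RofUk L m n φ η U s) = RofUk L m n φ η U s :=
    fun s => by unfold RofUk B11Eq103H1Complex.RLatticeK; exact projR_projR _ _ s
  -- the constant (every term is linear in `θ`; the `δ`-terms vanish)
  have hCfin : (θ / g * g0⁻¹ + (((θ * Real.sqrt (CK / g0) + 0 * CK) / g + Real.sqrt (C₁ / g) * (0 * Real.sqrt (CK / g0))) * MQ * g⁻¹ +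
      Real.sqrt (CK / g0) * (0 * g⁻¹ + MQ * (θ / g) * g0⁻¹)) + (Real.sqrt (g⁻¹ * 4) * (0 * g⁻¹ + 1 * (θ / g) * g0⁻¹) +
      (g⁻¹ * 0 * 1 + Real.sqrt (g⁻¹ * g⁻¹) * 0 + θ / g * Real.sqrt (2 / g0)) * 1 * g0⁻¹)) = Cb * θ := by
    rw [hCbdef]; ring
  refine ⟨?_, ?_, ?_⟩
  · rw [← hCfin]
    have h := norm_apply_frakG_sub_le (𝕜 := ℂ) hposU hadj hinj hpos₁ hadj hinj N hN0 hNn hg hg0 hθ0 le_rfl hCK hC₁ hMQ le_rfl zero_le_one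
      (by norm_num : (0 : ℝ) ≤ 2) (by norm_num : (0 : ℝ) ≤ 4) le_rfl le_rfl zero_le_one hcoer1 hcoer0 hT hQd hK hK₁ hQb hQb hPd hP0 hRD1 hRD0 hDDU hDDU
      hRsymU hRsymU hRRU hRRU hDs0 hDd hRd hR1 (LinearMap.id : BondL2K ℂ d (towerP L m (n + 1)) c₀ W →ₗ[ℂ] BondL2K ℂ d (towerP L m (n + 1)) c₀ W) hNid x
    rw [LinearMap.id_apply] at h
    exact h
  · rw [← hCfin]
    exact norm_apply_frakG_sub_le (𝕜 := ℂ) hposU hadj hinj hpos₁ hadj hinj N hN0 hNn hg hg0 hθ0 le_rfl hCK hC₁ hMQ le_rfl zero_le_one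
      (by norm_num : (0 : ℝ) ≤ 2) (by norm_num : (0 : ℝ) ≤ 4) le_rfl le_rfl zero_le_one hcoer1 hcoer0 hT hQd hK hK₁ hQb hQb hPd hP0 hRD1 hRD0 hDDU hDDU
      hRsymU hRsymU hRRU hRRU hDs0 hDd hRd hR1 (covCurlL2K ℂ c₀ ((η : ℂ))⁻¹ (adTransportW φ (fun _ : Bond d (towerP L m (n + 1)) => (1 : 𝔸ˣ)))) hNc x
  · rw [← hCfin]
    exact norm_apply_frakG_sub_le (𝕜 := ℂ) hposU hadj hinj hpos₁ hadj hinj N hN0 hNn hg hg0 hθ0 le_rfl hCK hC₁ hMQ le_rfl zero_le_one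
      (by norm_num : (0 : ℝ) ≤ 2) (by norm_num : (0 : ℝ) ≤ 4) le_rfl le_rfl zero_le_one hcoer1 hcoer0 hT hQd hK hK₁ hQb hQb hPd hP0 hRD1 hRD0 hDDU hDDU
      hRsymU hRsymU hRRU hRRU hDs0 hDd hRd hR1 (covDivL2K ℂ c₀ ((η : ℂ))⁻¹ (adTransportW φ fun _ : Bond d (towerP L m (n + 1)) => (1 : 𝔸ˣ)⁻¹)) hNd x

end Literature.MathematicalPhysics.QuantumFieldTheory.Balaban1983to89.B9Eq3153FrakGkLipschitzSlotDiagonal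

end
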